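import Summits.ResolutionOfSingularities.ResolutionOfSingularities.Theorems.EquisingularLiftEquisingularLiftNatPrefixSupplierDefs
import Summits.ResolutionOfSingularities.ResolutionOfSingularities.Theorems.EquisingularLiftEquisingularLiftNatPrefixPtRamStep
import HarnessLib

/-!
# [OURS · L1 W4.5(b) · EL♮(3) · WIDTH TABLE W₂ «Σ-SECTION ROUND», engine bullet (P-ram)] THE HOSTLESS RAMIFIED POINT STEP SUPPLIER `TCPlus.hpram_supplier : HPRamSupplier k 3`
# = res-L1-w45b-stub-2's ✓ `prefix_ptRam_step` (`…NatPrefixPtRamStep`, p707883: the port of ✓ `fatPointStep_model`, the B₄ «(pt-ram)» bullet of the nose towers) in the ISO prefix engine's slot currency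

res-L1-w45b-stub-4 g15 (desk RULING R73a (ii): «(P-ram) = the nose engine's B₄ bullet ported to the ISO prefix engine; owner stub-4»).  WHAT.  The K5⁹ slot
`HPRamSupplier k n` (`…NatPrefixSupplierDefs`) asks: from an upstairs stage `(X', σ', S')` of the chain with a model square `j : F₁ → X'` over `Spec k → Spec O` and
`j '' T₁ = S'`, given the (P-ram) letters of res-type-027's `PrefixReachKeyLetterParam9` — a closed point `y` of `T̃₁ = (closure T₁)_red` where `T̃₁` is NOT regular,
the ambient `F₁` NOT regular at `pt := curvePt F₁ T₁ y`, an ideal `J` with `J.support = {pt}` generated in the stalk by three elements of `𝔪` independent in `𝔪/𝔪²`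
(the trace of a RAMIFIED multisection), and the blow-up `υ₂ : F₂ → F₁` of `J` — produce a new upstairs stage `(X₉, σ₉, S₉)` in the chain, integral, locally
noetherian, regular, dominant, with a model square for `F₂` and `j₉ '' St T₁ = S₉`, `St T₁ = closure (υ₂⁻¹(T₁ ∖ {pt}))` closed irreducible, `F₂` integral.
HOW.  At `n = 3` this is ONE call of res-L1-w45b-stub-2's ✓ `prefix_ptRam_step` (p707883; = ✓ `fatPointStep_model`, res-L1-w45b-stub-4 g11, [cite: Liu2002, §8.1 and
Thm. 8.1.19]: the curvilinear fat point lifts to a regular `O`-flat multisection `C ⊂ X'` with `C.comap j = J`; its blow-up is the new stage, the model square and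
`j₂ '' St T₁ = S''` come with it; the three readings `pt ∈ T₁`, `T₁ ⊄ {pt}`, «`σ' (j pt)` off the generic point of `Y`» are done inside that lemma), with the letters
re-ordered into the slot's ∃-block.  The letter «ambient not regular at `pt`» is not read (honest over-hypothesis of the door).
OURS; NOT a statement of any manuscript ([Hironaka2017] is a candidate under adjudication, nothing of it is asserted); AI-written, weaker than expert review.
No `sorry`; standard axioms; DEF-FREE.  `--supports stmt-ResolutionOfSingularities-20148 --as helper`.  EL♮(3) is NOT proved by this file.
[folklore; pure repackaging of ✓ `prefix_ptRam_step` / ✓ `fatPointStep_model`]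
-/

set_option linter.dupNamespace false -- mandated namespace `Summit.<Summit>.<Problem>` of this single-conjunct summit

noncomputable section

open CategoryTheory CategoryTheory.Limits AlgebraicGeometry TopologicalSpace Topology IsLocalRing
open Literature.AlgebraicGeometry.Resolution AlgebraicGeometry.Scheme.IdealSheafData
open Summit.ResolutionOfSingularities.ResolutionOfSingularities.Theses.EquisingularLift.Split
open Summit.ResolutionOfSingularities.ResolutionOfSingularities.Cruxes.EquisingularLift.StrataSplit

namespace Summit.ResolutionOfSingularities.ResolutionOfSingularities.Cruxes.EquisingularLiftNat.Sections

/-- **HPRAM at `n = 3`: the hostless RAMIFIED POINT STEP supplier of the W₂ ISO engine K5⁹** — ✓ `prefix_ptRam_step` (res-L1-w45b-stub-2) in the slot currency `HPRamSupplier k 3`.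
See the module docstring. [OURS · L1 W4.5b · engine bullet (P-ram) of desk R73a (ii); NOT a statement of the manuscript; EL♮(3) NOT proved] -/
theorem TCPlus.hpram_supplier (k : Type) [Field k] : HPRamSupplier k 3 := by
  intro O _ _ _ _ _ θ hθ P q Y Ch hStep hChain hYsp hYirr hYcl hPint hPnoeth hPreg hqprop hqsm X' σ' S' hCh hX'int hX'noeth hX'reg hdom F₁ hF₁ j t hsq
    T₁ hT₁cl hT₁irr hTS y J F₂ υ₂ hTreg _hFreg hJsupp hJgen hυ₂
  haveI := hPint
  haveI := hqprop
  haveI := hqsm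
  haveI := hX'int
  haveI := hF₁
  obtain ⟨hF₂, -, hT₂irr, X'', τ, S'', j₂, t₂, hCh'', hint'', hnoeth'', hreg'', hdom'', -, hsq₂, -, hsets⟩ :=
    prefix_ptRam_step O k θ hθ P q Y hYsp hYirr hYcl hPnoeth hPreg 3 Ch hChain hStep X' σ' S' hCh hdom F₁ j t hsq T₁ hT₁cl hTS
      y J F₂ υ₂ hTreg hJsupp hJgen hυ₂
  exact ⟨X'', τ ≫ σ', S'', j₂, t₂, hCh'', hint'', hnoeth'', hreg'', hdom'', hsq₂, hsets, isClosed_closure, hT₂irr, hF₂⟩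

end Summit.ResolutionOfSingularities.ResolutionOfSingularities.Cruxes.EquisingularLiftNat.Sections

end
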